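import Mathlib
import Summits.Ventures.PercRepro2.Defs
import Summits.Ventures.PercRepro2.Graph
import Summits.Ventures.PercRepro2.Events
import Summits.Ventures.PercRepro2.Harris
import Summits.Ventures.PercRepro2.BHKAvoid
import Summits.Ventures.PercRepro2.OrderPreservation

/-!
# (ATT-b) is a theorem: a four-term certificate over BHK06 Thm 1.4 with set avoidance
(blind cell PercRepro2, mine-a g9; MINE-A.md §51, answer to night-1 g6's (ATT-b) question)

Night-1's reduction (`HMFPendantB.HMF_pendant_b`): (HMF), hence (HCOV), at a pendant `a₃` at the
marker `b` follows from ONE inequality about the `a₃`-free graph under `Q = {a₁ ↮ a₂}`,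

  `attB = (Z + B_L) s_LH + (Z + B_H) s_HL − B_H s_LL − B_L s_HH ≥ 0`

in the masses `Z = P(Q)`, `A_L = P(Q, a₁ ↔ o)`, `A_H = P(Q, a₂ ↔ o)`, `B_L = P(Q, a₁ ↔ b)`,
`B_H = P(Q, a₂ ↔ b)`, `x_LL = P(Q, a₁ ↔ b, a₁ ↔ o)`, `x_LH = P(Q, a₂ ↔ b, a₁ ↔ o)`,
`x_HL = P(Q, a₁ ↔ b, a₂ ↔ o)`, `x_HH = P(Q, a₂ ↔ b, a₂ ↔ o)` and the four BHK slacks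
`s_LH = A_L B_H − Z x_LH`, `s_HL = A_H B_L − Z x_HL` (cross, `≥ 0`), `s_LL = Z x_LL − A_L B_L`,
`s_HH = Z x_HH − A_H B_H` (same cluster, `≥ 0`).

**Certificate** (`attB_expr_eq`, a polynomial identity):

  `attB = Z · I₁ + Z · I₂ + 2 B_L · s_LH + 2 B_H · s_HL`,

  `I₁ = (A_L − x_LL) B_H − x_LH (Z − B_L)`, `I₂ = (A_H − x_HH) B_L − x_HL (Z − B_H)`,

where `I₁ ≥ 0` is `bhk_cross_cluster_avoid` with `s = a₁`, `t = a₂`, the avoided set `X = {a₂, b}`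
and the up-sets `{o ∈ ·}` (for `C(a₁)`), `{b ∈ ·}` (for `C(a₂)`):
`P(oL, bH, a₁ ↮ {a₂, b}) · P(a₁ ↮ {a₂, b}) ≤ P(oL, a₁ ↮ {a₂, b}) · P(bH, a₁ ↮ {a₂, b})`, i.e.
`x_LH (Z − B_L) ≤ (A_L − x_LL) B_H` (under `Q`, `b ∈ C(a₂)` forces `a₁ ↮ b`), `I₂ ≥ 0` is its
mirror (`s = a₂`, `t = a₁`, `X = {a₁, b}`), and `s_LH, s_HL ≥ 0` are the plain instances
(`X = {t}`). In covariance form, `I₁` says `|Cov_μ(oL, bH)| · (1 − μ(bL)) ≥ μ(bH) · Cov_μ(oL, bL)`: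
the cross covariance conditioned on `a₁ ↮ b` still dominates the same-cluster covariance times
`μ(bH)` — so the `B_H s_LL` term of `attB` is paid by `(Z − B_L) s_LH`, with `2 B_L s_LH` to spare.
Exact check: 600 random weighted instances (n ≤ 7), identity and all four signs (data/mine-a/g9).

`attB_expr_nonneg` is stated on the literal body of `HMFPendantB.attB`, so that
`HMFPendantB.attB_nonneg` is `attB_expr_nonneg` by `unfold`.
-/

namespace Summit.Ventures.PercRepro2
namespace AttB

variable {V : Type*} {E : Type*} [Fintype E] [DecidableEq E] [Fintype V] [DecidableEq V]
  {R : Type*} [Field R] [LinearOrder R] [IsStrictOrderedRing R]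

section Events

variable (ends : E → Sym2 V) (o a₁ a₂ b : V)

omit [Fintype E] [DecidableEq E] [Fintype V] [DecidableEq V] in
/-- `{a₁ ↮ a₂} = {a₂ ↮ a₁}`. -/
lemma Q_comm : avoidAll ends a₁ {a₂} = avoidAll ends a₂ {a₁} := by
  ext ω
  simp only [mem_avoidAll, Finset.mem_singleton, forall_eq]
  exact ⟨fun h h' => h (conn_symm h'), fun h h' => h (conn_symm h')⟩

omit [Fintype E] [DecidableEq E] [Fintype V] in
/-- `{a₁ ↮ {a₂, b}} = Q ∩ {a₁ ↮ b}`. -/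
lemma avoidAll_pair_eq :
    avoidAll ends a₁ {a₂, b} = avoidAll ends a₂ {a₁} ∩ (connEvent ends a₁ b)ᶜ := by
  ext ω
  simp only [mem_avoidAll, Finset.mem_insert, Finset.mem_singleton, forall_eq_or_imp, forall_eq,
    Set.mem_inter_iff, Set.mem_compl_iff, mem_connEvent]
  exact ⟨fun h => ⟨fun h' => h.1 (conn_symm h'), h.2⟩, fun h => ⟨fun h' => h.1 (conn_symm h'), h.2⟩⟩

omit [Fintype E] [DecidableEq E] [Fintype V] in
/-- `{a₂ ↮ {a₁, b}} = Q ∩ {a₂ ↮ b}`. -/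
lemma avoidAll_pair_eq' :
    avoidAll ends a₂ {a₁, b} = avoidAll ends a₂ {a₁} ∩ (connEvent ends a₂ b)ᶜ := by
  ext ω
  simp only [mem_avoidAll, Finset.mem_insert, Finset.mem_singleton, forall_eq_or_imp, forall_eq,
    Set.mem_inter_iff, Set.mem_compl_iff, mem_connEvent]

omit [Fintype E] [DecidableEq E] [Fintype V] [DecidableEq V] in
/-- Under `Q`, `b ∈ C(a₂)` forces `a₁ ↮ b`. -/
lemma not_conn_left_of_right {ω : Config E} (hQ : ω ∈ avoidAll ends a₂ {a₁})
    (hb : Conn ends ω a₂ b) : ¬ Conn ends ω a₁ b := fun h =>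
  (mem_avoidAll.1 hQ) a₁ (Finset.mem_singleton_self a₁) (conn_trans hb (conn_symm h))

omit [Fintype E] [DecidableEq E] [Fintype V] [DecidableEq V] in
/-- Under `Q`, `b ∈ C(a₁)` forces `a₂ ↮ b`. -/
lemma not_conn_right_of_left {ω : Config E} (hQ : ω ∈ avoidAll ends a₂ {a₁})
    (hb : Conn ends ω a₁ b) : ¬ Conn ends ω a₂ b := fun h =>
  (mem_avoidAll.1 hQ) a₁ (Finset.mem_singleton_self a₁) (conn_trans h (conn_symm hb))

omit [Fintype E] [DecidableEq E] [Fintype V] [DecidableEq V] in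
/-- The `I₁` numerator event: `oL ∩ bH ∩ (Q ∩ {a₁ ↮ b}) = Q ∩ bH ∩ oL`. -/
lemma I1_top_eq :
    connEvent ends a₁ o ∩ connEvent ends a₂ b ∩ (avoidAll ends a₂ {a₁} ∩ (connEvent ends a₁ b)ᶜ) =
      avoidAll ends a₂ {a₁} ∩ connEvent ends a₂ b ∩ connEvent ends a₁ o := by
  ext ω
  simp only [Set.mem_inter_iff, Set.mem_compl_iff, mem_connEvent]
  constructor
  · rintro ⟨⟨ho, hb⟩, hQ, _⟩; exact ⟨⟨hQ, hb⟩, ho⟩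
  · rintro ⟨⟨hQ, hb⟩, ho⟩; exact ⟨⟨ho, hb⟩, hQ, not_conn_left_of_right ends a₁ a₂ b hQ hb⟩

omit [Fintype E] [DecidableEq E] [Fintype V] [DecidableEq V] in
/-- `oL ∩ (Q ∩ {a₁ ↮ b}) = (Q ∩ oL) ∩ bLᶜ`. -/
lemma I1_left_eq :
    connEvent ends a₁ o ∩ (avoidAll ends a₂ {a₁} ∩ (connEvent ends a₁ b)ᶜ) =
      (avoidAll ends a₂ {a₁} ∩ connEvent ends a₁ o) ∩ (connEvent ends a₁ b)ᶜ := by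
  ext ω; simp only [Set.mem_inter_iff, Set.mem_compl_iff]; tauto

omit [Fintype E] [DecidableEq E] [Fintype V] [DecidableEq V] in
/-- `(Q ∩ oL) ∩ bL = Q ∩ bL ∩ oL`. -/
lemma QoL_bL_eq :
    (avoidAll ends a₂ {a₁} ∩ connEvent ends a₁ o) ∩ connEvent ends a₁ b =
      avoidAll ends a₂ {a₁} ∩ connEvent ends a₁ b ∩ connEvent ends a₁ o := by
  ext ω; simp only [Set.mem_inter_iff]; tauto

omit [Fintype E] [DecidableEq E] [Fintype V] [DecidableEq V] in
/-- `bH ∩ (Q ∩ {a₁ ↮ b}) = Q ∩ bH`. -/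
lemma I1_right_eq :
    connEvent ends a₂ b ∩ (avoidAll ends a₂ {a₁} ∩ (connEvent ends a₁ b)ᶜ) =
      avoidAll ends a₂ {a₁} ∩ connEvent ends a₂ b := by
  ext ω
  simp only [Set.mem_inter_iff, Set.mem_compl_iff, mem_connEvent]
  constructor
  · rintro ⟨hb, hQ, _⟩; exact ⟨hQ, hb⟩
  · rintro ⟨hQ, hb⟩; exact ⟨hb, hQ, not_conn_left_of_right ends a₁ a₂ b hQ hb⟩

omit [Fintype E] [DecidableEq E] [Fintype V] [DecidableEq V] in
/-- The `I₂` numerator event: `oH ∩ bL ∩ (Q ∩ {a₂ ↮ b}) = Q ∩ bL ∩ oH`. -/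
lemma I2_top_eq :
    connEvent ends a₂ o ∩ connEvent ends a₁ b ∩ (avoidAll ends a₂ {a₁} ∩ (connEvent ends a₂ b)ᶜ) =
      avoidAll ends a₂ {a₁} ∩ connEvent ends a₁ b ∩ connEvent ends a₂ o := by
  ext ω
  simp only [Set.mem_inter_iff, Set.mem_compl_iff, mem_connEvent]
  constructor
  · rintro ⟨⟨ho, hb⟩, hQ, _⟩; exact ⟨⟨hQ, hb⟩, ho⟩
  · rintro ⟨⟨hQ, hb⟩, ho⟩; exact ⟨⟨ho, hb⟩, hQ, not_conn_right_of_left ends a₁ a₂ b hQ hb⟩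

omit [Fintype E] [DecidableEq E] [Fintype V] [DecidableEq V] in
/-- `oH ∩ (Q ∩ {a₂ ↮ b}) = (Q ∩ oH) ∩ bHᶜ`. -/
lemma I2_left_eq :
    connEvent ends a₂ o ∩ (avoidAll ends a₂ {a₁} ∩ (connEvent ends a₂ b)ᶜ) =
      (avoidAll ends a₂ {a₁} ∩ connEvent ends a₂ o) ∩ (connEvent ends a₂ b)ᶜ := by
  ext ω; simp only [Set.mem_inter_iff, Set.mem_compl_iff]; tauto

omit [Fintype E] [DecidableEq E] [Fintype V] [DecidableEq V] in
/-- `(Q ∩ oH) ∩ bH = Q ∩ bH ∩ oH`. -/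
lemma QoH_bH_eq :
    (avoidAll ends a₂ {a₁} ∩ connEvent ends a₂ o) ∩ connEvent ends a₂ b =
      avoidAll ends a₂ {a₁} ∩ connEvent ends a₂ b ∩ connEvent ends a₂ o := by
  ext ω; simp only [Set.mem_inter_iff]; tauto

omit [Fintype E] [DecidableEq E] [Fintype V] [DecidableEq V] in
/-- `bL ∩ (Q ∩ {a₂ ↮ b}) = Q ∩ bL`. -/
lemma I2_right_eq :
    connEvent ends a₁ b ∩ (avoidAll ends a₂ {a₁} ∩ (connEvent ends a₂ b)ᶜ) =
      avoidAll ends a₂ {a₁} ∩ connEvent ends a₁ b := by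
  ext ω
  simp only [Set.mem_inter_iff, Set.mem_compl_iff, mem_connEvent]
  constructor
  · rintro ⟨hb, hQ, _⟩; exact ⟨hQ, hb⟩
  · rintro ⟨hQ, hb⟩; exact ⟨hb, hQ, not_conn_right_of_left ends a₁ a₂ b hQ hb⟩

omit [Fintype E] [DecidableEq E] [Fintype V] [DecidableEq V] in
/-- `oL ∩ bH ∩ Q = Q ∩ bH ∩ oL`. -/
lemma S1_top_eq :
    connEvent ends a₁ o ∩ connEvent ends a₂ b ∩ avoidAll ends a₂ {a₁} =
      avoidAll ends a₂ {a₁} ∩ connEvent ends a₂ b ∩ connEvent ends a₁ o := by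
  ext ω; simp only [Set.mem_inter_iff]; tauto

omit [Fintype E] [DecidableEq E] [Fintype V] [DecidableEq V] in
/-- `oH ∩ bL ∩ Q = Q ∩ bL ∩ oH`. -/
lemma S2_top_eq :
    connEvent ends a₂ o ∩ connEvent ends a₁ b ∩ avoidAll ends a₂ {a₁} =
      avoidAll ends a₂ {a₁} ∩ connEvent ends a₁ b ∩ connEvent ends a₂ o := by
  ext ω; simp only [Set.mem_inter_iff]; tauto

end Events

section Instances

variable (p : E → R) (ends : E → Sym2 V) (o a₁ a₂ b : V)

/-- **`I₁ ≥ 0`** — `bhk_cross_cluster_avoid` with `s = a₁`, `t = a₂`, `X = {a₂, b}`: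
`x_LH · (Z − B_L) ≤ (A_L − x_LL) · B_H`. -/
theorem I1 (hp : IsProbVec p) :
    prob p (avoidAll ends a₂ {a₁} ∩ connEvent ends a₂ b ∩ connEvent ends a₁ o) *
        (prob p (avoidAll ends a₂ {a₁}) - prob p (avoidAll ends a₂ {a₁} ∩ connEvent ends a₁ b)) ≤
      (prob p (avoidAll ends a₂ {a₁} ∩ connEvent ends a₁ o) -
          prob p (avoidAll ends a₂ {a₁} ∩ connEvent ends a₁ b ∩ connEvent ends a₁ o)) *
        prob p (avoidAll ends a₂ {a₁} ∩ connEvent ends a₂ b) := by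
  have h := bhk_cross_cluster_avoid p hp ends a₁ a₂ (X := {a₂, b}) (Finset.mem_insert_self a₂ {b})
    (isUpperSet_mem_setOf o) (isUpperSet_mem_setOf b)
  rw [← connEvent_eq_clusterInEvent ends a₁ o, ← connEvent_eq_clusterInEvent ends a₂ b,
    avoidAll_pair_eq ends a₁ a₂ b, I1_top_eq ends o a₁ a₂ b, I1_left_eq ends o a₁ a₂ b,
    I1_right_eq ends a₁ a₂ b] at h
  have e1 := prob_inter_add_prob_inter_compl p (avoidAll ends a₂ {a₁}) (connEvent ends a₁ b)
  have e2 := prob_inter_add_prob_inter_compl p (avoidAll ends a₂ {a₁} ∩ connEvent ends a₁ o)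
    (connEvent ends a₁ b)
  rw [QoL_bL_eq ends o a₁ a₂ b] at e2
  have e1' : prob p (avoidAll ends a₂ {a₁} ∩ (connEvent ends a₁ b)ᶜ) =
      prob p (avoidAll ends a₂ {a₁}) - prob p (avoidAll ends a₂ {a₁} ∩ connEvent ends a₁ b) := by
    linarith
  have e2' : prob p ((avoidAll ends a₂ {a₁} ∩ connEvent ends a₁ o) ∩ (connEvent ends a₁ b)ᶜ) =
      prob p (avoidAll ends a₂ {a₁} ∩ connEvent ends a₁ o) -
        prob p (avoidAll ends a₂ {a₁} ∩ connEvent ends a₁ b ∩ connEvent ends a₁ o) := by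
    linarith
  rw [e1', e2'] at h
  exact h

/-- **`I₂ ≥ 0`** — the mirror instance (`s = a₂`, `t = a₁`, `X = {a₁, b}`):
`x_HL · (Z − B_H) ≤ (A_H − x_HH) · B_L`. -/
theorem I2 (hp : IsProbVec p) :
    prob p (avoidAll ends a₂ {a₁} ∩ connEvent ends a₁ b ∩ connEvent ends a₂ o) *
        (prob p (avoidAll ends a₂ {a₁}) - prob p (avoidAll ends a₂ {a₁} ∩ connEvent ends a₂ b)) ≤
      (prob p (avoidAll ends a₂ {a₁} ∩ connEvent ends a₂ o) -
          prob p (avoidAll ends a₂ {a₁} ∩ connEvent ends a₂ b ∩ connEvent ends a₂ o)) *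
        prob p (avoidAll ends a₂ {a₁} ∩ connEvent ends a₁ b) := by
  have h := bhk_cross_cluster_avoid p hp ends a₂ a₁ (X := {a₁, b}) (Finset.mem_insert_self a₁ {b})
    (isUpperSet_mem_setOf o) (isUpperSet_mem_setOf b)
  rw [← connEvent_eq_clusterInEvent ends a₂ o, ← connEvent_eq_clusterInEvent ends a₁ b,
    avoidAll_pair_eq' ends a₁ a₂ b, I2_top_eq ends o a₁ a₂ b, I2_left_eq ends o a₁ a₂ b,
    I2_right_eq ends a₁ a₂ b] at h
  have e1 := prob_inter_add_prob_inter_compl p (avoidAll ends a₂ {a₁}) (connEvent ends a₂ b)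
  have e2 := prob_inter_add_prob_inter_compl p (avoidAll ends a₂ {a₁} ∩ connEvent ends a₂ o)
    (connEvent ends a₂ b)
  rw [QoH_bH_eq ends o a₁ a₂ b] at e2
  have e1' : prob p (avoidAll ends a₂ {a₁} ∩ (connEvent ends a₂ b)ᶜ) =
      prob p (avoidAll ends a₂ {a₁}) - prob p (avoidAll ends a₂ {a₁} ∩ connEvent ends a₂ b) := by
    linarith
  have e2' : prob p ((avoidAll ends a₂ {a₁} ∩ connEvent ends a₂ o) ∩ (connEvent ends a₂ b)ᶜ) =
      prob p (avoidAll ends a₂ {a₁} ∩ connEvent ends a₂ o) -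
        prob p (avoidAll ends a₂ {a₁} ∩ connEvent ends a₂ b ∩ connEvent ends a₂ o) := by
    linarith
  rw [e1', e2'] at h
  exact h

/-- **`s_LH ≥ 0`** — the plain cross instance (`s = a₁`, `t = a₂`, `X = {a₂}`): `Z · x_LH ≤ A_L · B_H`. -/
theorem S1 (hp : IsProbVec p) :
    prob p (avoidAll ends a₂ {a₁} ∩ connEvent ends a₂ b ∩ connEvent ends a₁ o) *
        prob p (avoidAll ends a₂ {a₁}) ≤
      prob p (avoidAll ends a₂ {a₁} ∩ connEvent ends a₁ o) *
        prob p (avoidAll ends a₂ {a₁} ∩ connEvent ends a₂ b) := by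
  have h := bhk_cross_cluster_avoid p hp ends a₁ a₂ (X := {a₂}) (Finset.mem_singleton_self a₂)
    (isUpperSet_mem_setOf o) (isUpperSet_mem_setOf b)
  rw [← connEvent_eq_clusterInEvent ends a₁ o, ← connEvent_eq_clusterInEvent ends a₂ b,
    Q_comm ends a₁ a₂, S1_top_eq ends o a₁ a₂ b, Set.inter_comm (connEvent ends a₁ o),
    Set.inter_comm (connEvent ends a₂ b)] at h
  exact h

/-- **`s_HL ≥ 0`** — the plain cross instance (`s = a₂`, `t = a₁`, `X = {a₁}`): `Z · x_HL ≤ A_H · B_L`. -/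
theorem S2 (hp : IsProbVec p) :
    prob p (avoidAll ends a₂ {a₁} ∩ connEvent ends a₁ b ∩ connEvent ends a₂ o) *
        prob p (avoidAll ends a₂ {a₁}) ≤
      prob p (avoidAll ends a₂ {a₁} ∩ connEvent ends a₂ o) *
        prob p (avoidAll ends a₂ {a₁} ∩ connEvent ends a₁ b) := by
  have h := bhk_cross_cluster_avoid p hp ends a₂ a₁ (X := {a₁}) (Finset.mem_singleton_self a₁)
    (isUpperSet_mem_setOf o) (isUpperSet_mem_setOf b)
  rw [← connEvent_eq_clusterInEvent ends a₂ o, ← connEvent_eq_clusterInEvent ends a₁ b,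
    S2_top_eq ends o a₁ a₂ b, Set.inter_comm (connEvent ends a₂ o),
    Set.inter_comm (connEvent ends a₁ b)] at h
  exact h

end Instances

section Main

variable (p : E → R) (ends : E → Sym2 V)

/-- **(ATT-b) as an explicit inequality** — the literal body of `HMFPendantB.attB` is `≥ 0`:
`attB = Z · I₁ + Z · I₂ + 2 B_L · s_LH + 2 B_H · s_HL` with every factor nonnegative. -/
theorem attB_expr_nonneg (hp : IsProbVec p) (o a₁ a₂ b : V) :
    0 ≤ (prob p (avoidAll ends a₂ {a₁}) + prob p (avoidAll ends a₂ {a₁} ∩ connEvent ends a₁ b)) *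
          (prob p (avoidAll ends a₂ {a₁} ∩ connEvent ends a₁ o) *
              prob p (avoidAll ends a₂ {a₁} ∩ connEvent ends a₂ b) -
            prob p (avoidAll ends a₂ {a₁}) *
              prob p (avoidAll ends a₂ {a₁} ∩ connEvent ends a₂ b ∩ connEvent ends a₁ o)) +
        (prob p (avoidAll ends a₂ {a₁}) + prob p (avoidAll ends a₂ {a₁} ∩ connEvent ends a₂ b)) *
          (prob p (avoidAll ends a₂ {a₁} ∩ connEvent ends a₂ o) *
              prob p (avoidAll ends a₂ {a₁} ∩ connEvent ends a₁ b) -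
            prob p (avoidAll ends a₂ {a₁}) *
              prob p (avoidAll ends a₂ {a₁} ∩ connEvent ends a₁ b ∩ connEvent ends a₂ o)) -
        prob p (avoidAll ends a₂ {a₁} ∩ connEvent ends a₂ b) *
          (prob p (avoidAll ends a₂ {a₁}) *
              prob p (avoidAll ends a₂ {a₁} ∩ connEvent ends a₁ b ∩ connEvent ends a₁ o) -
            prob p (avoidAll ends a₂ {a₁} ∩ connEvent ends a₁ o) *
              prob p (avoidAll ends a₂ {a₁} ∩ connEvent ends a₁ b)) -
        prob p (avoidAll ends a₂ {a₁} ∩ connEvent ends a₁ b) *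
          (prob p (avoidAll ends a₂ {a₁}) *
              prob p (avoidAll ends a₂ {a₁} ∩ connEvent ends a₂ b ∩ connEvent ends a₂ o) -
            prob p (avoidAll ends a₂ {a₁} ∩ connEvent ends a₂ o) *
              prob p (avoidAll ends a₂ {a₁} ∩ connEvent ends a₂ b)) := by
  have hZ := prob_nonneg hp (avoidAll ends a₂ {a₁})
  have hBL := prob_nonneg hp (avoidAll ends a₂ {a₁} ∩ connEvent ends a₁ b)
  have hBH := prob_nonneg hp (avoidAll ends a₂ {a₁} ∩ connEvent ends a₂ b)
  have h1 := I1 p ends o a₁ a₂ b hp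
  have h2 := I2 p ends o a₁ a₂ b hp
  have h3 := S1 p ends o a₁ a₂ b hp
  have h4 := S2 p ends o a₁ a₂ b hp
  nlinarith [mul_nonneg hZ (sub_nonneg.2 h1), mul_nonneg hZ (sub_nonneg.2 h2),
    mul_nonneg hBL (sub_nonneg.2 h3), mul_nonneg hBH (sub_nonneg.2 h4)]

end Main

end AttB
end Summit.Ventures.PercRepro2
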